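import Summits.QuantumFields.YangMills.Theorems.LuscherReductionDressedRitzPolyakovLiftDefs
import Summits.QuantumFields.YangMills.Theorems.LuscherReductionDressedRitzPlateauSortFree
import Summits.QuantumFields.YangMills.Theorems.FemtoTransferGapGroundState
import Summits.QuantumFields.YangMills.Theorems.FemtoTransferGapSpectral
import Summits.QuantumFields.YangMills.Theorems.FemtoTransferGapLevelsPos
import HarnessLib

/-!
# Route `LuscherReduction`, item `DressedRitz` (stmt-QuantumFields-20205), line «polyakovlift» — GLUE over tree constants:
# seams (§4 of the birth skeleton), the composition STATICS → DYNAMICS → LEAKAGE → `DressedRitz` with the stub BODIES as hypotheses, and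
# ★ the same composition with DYNAMICS weakened to its (o5)∧(o6) CORE (order and spread clauses discharged by the tree)

Support module of the `FemtoTransferGap` group (fleet service by seat ym-infvol-p2 g6; route `LuscherReduction`, femto rung R2b1; bears on the
crux child `DressedRitz` = stmt-QuantumFields-20205; line «polyakovlift», owner ym-beyond-p1 g21, skeleton `pub/ym-beyond/p1-g21-files/
Lines-polyakovlift.lean` 9b069c059f21b79f, stubs `stub_liftStatics` (L) ∕ `stub_liftDynamics` (XL) ∕ `stub_liftLeakage` (L∕XL)).

* §1 SEAMS (skeleton §4 re-homed): `isPhys_liftVec` (via the tree's `OpPlat.isPhys_ins`), `exists_liftBasis` (NON-VACUITY of the lift-basis class: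
  positive one-site ground state by Jentzsch + exact excited eigenfunctions, ratios `g_i = ψ_{i+1}/ω`), `liftBasis_reindex` (NEW: a relabelled lift
  basis is a lift basis — the labelling is free), `plateauClauses_of_parts` (merging the three clause groups by monotonicity in the constant).
* §2 COMPOSITION (skeleton §5–§6 with `Stmt.stub_*` replaced by their BODIES over the tree definitions of `…PolyakovLiftDefs.lean`):
  `operatorPlateauAt_of_liftParts`, ★ `dressedRitz_of_liftParts : S-STAT → S-DYN → S-LEAK → Theses.LuscherReduction.DressedRitz` (BY NAME, through the
  tree door `OpPlat.dressedRitz_of_operatorPlateau`).  When the owner re-points the registered stubs at the tree definitions, a stub landed by name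
  feeds these verbatim.
* §3 ★★ CORE COMPOSITION (NEW): `operatorPlateauAt_of_liftPartsCore`, `dressedRitz_of_liftPartsCore : S-STAT → S-DYN-CORE → S-LEAK → DressedRitz`,
  where S-DYN-CORE asks, for SOME lift basis, only `DynamicCoreClauses` = (o5) Lüscher position ∧ (o6) symmetrised couplings: the ORDER clause (o1)
  is produced by relabelling the basis by decreasing effective mass (`KTGen.operatorCore_of_unsorted`, using (o0) from S-STAT), the SPREAD clause
  (o7) by (o5) + the closed crux ONE (`KTGen.plateauClauses_of_core`).  RECOMMENDATION to the owner (no registry change made here): S-DYN may be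
  registered with `DynamicCoreClauses` in place of `DynamicClauses` — strictly less to prove, same crux by this glue.

HONEST FRAMING: fixed-lattice glue on the femto rung R2b1 (conditional `FemtoGapOfRecord`); the three clause groups are OPEN renormalisation-group
estimates and nothing of them is proved here; no bearing on infinite volume, the continuum limit or the Clay mass gap.
References: M. Lüscher, NPB 219 (1983) 233 [cite: Luscher1983, §3]; Lüscher–Wolff, NPB 339 (1990) 222 [cite: LuscherWolff1990];
Reed–Simon IV [cite: ReedSimonIV1978, Thm XIII.43]; M. Lüscher, JHEP 08 (2010) 071 [cite: Luscher2010, §2].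
-/

set_option autoImplicit false

noncomputable section

open MeasureTheory Filter Topology Real
open Literature.MathematicalPhysics.QuantumFieldTheory (GaugeConfig Site gaugeTransform)
open scoped BigOperators

namespace Summit.QuantumFields.YangMills.Theorems.FemtoTransferGap.PolyakovLift

open Summit.QuantumFields.YangMills.Theorems.FemtoTransferGap
open Summit.QuantumFields.YangMills.Theorems.FemtoTransferGap.KTRCalibration
open Summit.QuantumFields.YangMills.Theorems.FemtoTransferGap.KTGen
open Summit.QuantumFields.YangMills.Theorems.FemtoTransferGap.OpPlat
open Summit.QuantumFields.YangMills.Theorems.FemtoTransferGap.TraceDoor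

/-! ## §1 Seams (fixed lattice) -/

/-- The lifted channel vector is physical for a physical vacuum and a physical one-site function (`OpPlat.isPhys_ins` + `isPhys_flowLiftAt`).
[cite: Luscher2010, §2] -/
theorem isPhys_liftVec {L : ℕ} [NeZero L] (β : ℝ) {φ : GaugeConfig 3 L SU2 → ℝ} {g : GaugeConfig 3 1 SU2 → ℝ} (hφ : IsPhys φ)
    (hg : IsPhys g) : IsPhys (liftVec β φ g) :=
  OpPlat.isPhys_ins hφ (isPhys_flowLiftAt 0 _ hg)

/-- NON-VACUITY of the lift-basis class: for every one-site coupling `B > 0` and every `k` a one-site eigen-ratio basis EXISTS — positive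
ground state by Jentzsch (`PhysL2.exists_groundState` at `L = 1`), exact excited eigenfunctions by Hilbert–Schmidt + min–max
(`PhysL2.exists_isPhys_eigenfamily`), ratios `g_i = ψ_{i+1}/ω`.  So the `∀`-stubs STATICS ∕ LEAKAGE are not vacuous and DYNAMICS has candidates.
[cite: ReedSimonIV1978, Thm XIII.43–44] -/
theorem exists_liftBasis {B : ℝ} (hB : 0 < B) (k : ℕ) :
    ∃ (ω : GaugeConfig 3 1 SU2 → ℝ) (g : Fin k → (GaugeConfig 3 1 SU2 → ℝ)), LiftBasis B k ω g := by
  obtain ⟨Ω, θ, c, hΩ, hc, hcle, hn, heig, -, -, -⟩ := PhysL2.exists_groundState (L := 1) B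
  obtain ⟨ψ, hψ, hon, heψ⟩ := PhysL2.exists_isPhys_eigenfamily (L := 1) hB.le k (levelValue_su2Rep_pos hB k)
  have hΩne : ∀ V, Ω V ≠ 0 := fun V => (hc.trans_le (hcle V)).ne'
  have hmul : ∀ i : Fin k, ((fun V => ψ i.succ V / Ω V) * Ω) = ψ i.succ := fun i => by
    funext V; simp only [Pi.mul_apply]; exact div_mul_cancel₀ _ (hΩne V)
  refine ⟨Ω, fun i => fun V => ψ i.succ V / Ω V, hΩ, ⟨c, hc, hcle⟩, hn, by rw [levelValue_zero]; exact heig, ?_, ?_, ?_⟩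
  · intro i
    obtain ⟨Cψ, hCψ⟩ := (hψ i.succ).bounded
    refine ⟨(hψ i.succ).measurable.div hΩ.measurable, ⟨Cψ / c, fun V => ?_⟩, fun g V => ?_, fun d z hz V => ?_⟩
    · show |ψ i.succ V / Ω V| ≤ Cψ / c
      rw [abs_div]
      exact div_le_div₀ ((abs_nonneg _).trans (hCψ V)) (hCψ V) hc ((hcle V).trans (le_abs_self _))
    · show ψ i.succ (gaugeTransform g V) / Ω (gaugeTransform g V) = ψ i.succ V / Ω V
      rw [(hψ i.succ).gaugeInv g V, hΩ.gaugeInv g V]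
    · show ψ i.succ (twist d z V) / Ω (twist d z V) = ψ i.succ V / Ω V
      rw [(hψ i.succ).zeroFlux d z hz V, hΩ.zeroFlux d z hz V]
  · refine ⟨Equiv.refl _, fun i => ?_⟩
    have h := heψ i.succ
    rw [Fin.val_succ] at h
    rw [Equiv.refl_apply, hmul i]; exact h
  · intro i l
    rw [hmul i, hmul l, hon]
    simp only [Fin.succ_inj]

/-- NEW: **a relabelled lift basis is a lift basis** — `LiftBasis B k ω g → LiftBasis B k ω (g ∘ σ)` for every permutation `σ` (the level
labelling inside `LiftBasis` is existential, orthonormality is permutation-invariant): the labelling of the channels is the prover's to choose.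
[folklore] -/
theorem liftBasis_reindex {B : ℝ} {k : ℕ} {ω : GaugeConfig 3 1 SU2 → ℝ} {g : Fin k → (GaugeConfig 3 1 SU2 → ℝ)}
    (h : LiftBasis B k ω g) (σ : Equiv.Perm (Fin k)) : LiftBasis B k ω (fun i => g (σ i)) := by
  obtain ⟨hω, hc, hn, heig, hg, ⟨τ, hτ⟩, hon⟩ := h
  refine ⟨hω, hc, hn, heig, fun i => hg (σ i), ⟨σ.trans τ, fun i => ?_⟩, fun i l => ?_⟩
  · rw [Equiv.trans_apply]; exact hτ (σ i)
  · rw [hon (σ i) (σ l)]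
    simp only [σ.injective.eq_iff]

/-- MERGING: the three clause groups at constants `C₁, C₂, C₃ ≤ C` give `OpPlat.PlateauClauses k C` (monotonicity in `C`, using the sign facts
`λ ≥ 0`, `λ₀ ≥ 0`, `μ_j(B) ≥ 0`, `n_i ≥ 0`, `d_ii ≥ 0` in the window). [folklore] -/
theorem plateauClauses_of_parts {k : ℕ} {C₁ C₂ C₃ C : ℝ} {L : ℕ} [NeZero L] {lam β : ℝ} (hlam : 0 < lam)
    (hW : InFemtoWindow lam β L) {u : Fin k → (GaugeConfig 3 L SU2 → ℝ)} (hu : ∀ i, IsPhys (u i))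
    (h1 : C₁ ≤ C) (h2 : C₂ ≤ C) (h3 : C₃ ≤ C)
    (hS : StaticClauses k C₁ β u) (hD : DynamicClauses k C₂ β u) (hK : LeakageClause k C₃ β u) :
    OpPlat.PlateauClauses k C β u := by
  obtain ⟨h0, ho2⟩ := hS
  obtain ⟨ho1, ho5, ho6, ho7⟩ := hD
  have hβ0 : 0 ≤ β := zero_le_one.trans hW.1
  have hΛpos : 0 < luscherLambda β L := luscherLambda_pos_of_window hlam hW
  have hΛ : 0 ≤ luscherLambda β L := hΛpos.le
  have hLpos : (0 : ℝ) < L := Nat.cast_pos.mpr (NeZero.pos L)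
  have htop0 : 0 ≤ levelValue su2Rep L β 0 := (levelValue_pos_of_window hW 0).le
  have hBpos : 0 < oneSiteCoupling β L := by
    unfold oneSiteCoupling
    exact div_pos (mul_pos two_pos (pow_pos hLpos 3)) (pow_pos hΛpos 3)
  have hμ : ∀ j : ℕ, 0 ≤ levelValue su2Rep 1 (oneSiteCoupling β L) j := fun j => levelValue_su2Rep_nonneg 1 hBpos.le j
  have hn : ∀ i : Fin k, 0 ≤ l2 (u i) (u i) := fun i => l2_self_nonneg _
  have hd : ∀ i : Fin k, 0 ≤ l2 (u i) (transferApply β (u i)) := fun i => by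
    rw [← qform_eq_l2_transferApply]; exact qform_su2Rep_self_nonneg hβ0 (hu i)
  have hsq : ∀ i l : Fin k, 0 ≤ Real.sqrt (l2 (u i) (u i)) * Real.sqrt (l2 (u l) (u l)) :=
    fun i l => mul_nonneg (Real.sqrt_nonneg _) (Real.sqrt_nonneg _)
  have key : ∀ {a b x : ℝ}, a ≤ b → 0 ≤ x → a * x ≤ b * x := fun h hx => mul_le_mul_of_nonneg_right h hx
  have hexp : Real.exp (C₂ * luscherLambda β L ^ 2 / L) ≤ Real.exp (C * luscherLambda β L ^ 2 / L) :=
    Real.exp_le_exp.mpr (div_le_div_of_nonneg_right (key h2 (sq_nonneg _)) hLpos.le)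
  refine ⟨h0, ho1, ?_, ?_, ?_, ?_, ?_⟩
  · intro i l hil
    exact (ho2 i l hil).trans (key (key h1 hΛ) (hsq i l))
  · intro i
    exact (hK i).trans (key (key (key h3 (div_nonneg (pow_nonneg hΛ 3) (sq_nonneg _))) (sq_nonneg _)) (sq_nonneg _))
  · intro i
    refine ⟨(ho5 i).1.trans (key (key hexp (mul_nonneg (hμ _) htop0)) (hn i)), (ho5 i).2.trans (key hexp (mul_nonneg (hd i) (hμ 0)))⟩
  · intro i l hil
    exact (ho6 i l hil).trans (key (key (key h2 (div_nonneg (sq_nonneg _) hLpos.le)) htop0) (hsq i l))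
  · intro i
    exact (ho7 i).trans (key (key (key h2 (div_nonneg hΛ hLpos.le)) htop0) (hn i))

/-! ## §2 The composition with the stub BODIES as hypotheses (skeleton §5–§6 over tree constants) -/

/-- ★ STATICS ∧ DYNAMICS ∧ LEAKAGE (bodies of the three registered stubs of «polyakovlift», over the tree definitions) ⇒ `OpPlat.OperatorPlateauAt k`
at every level (vacuum = the Perron–Frobenius ground state, insertions = the flowed-Polyakov lifts of the DYNAMICS basis). [cite: Luscher1983, §3] -/
theorem operatorPlateauAt_of_liftParts
    (hS : ∀ k : ℕ, ∃ C lam0 : ℝ, 0 ≤ C ∧ 0 < lam0 ∧ ∀ lam : ℝ, 0 < lam → lam ≤ lam0 → ∃ L0 : ℕ,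
      ∀ (L : ℕ) [NeZero L], L0 ≤ L → ∀ β : ℝ, InFemtoWindow lam β L →
        ∀ φ : GaugeConfig 3 L SU2 → ℝ, IsRawVacuum β φ →
          ∀ (ω : GaugeConfig 3 1 SU2 → ℝ) (g : Fin k → (GaugeConfig 3 1 SU2 → ℝ)), LiftBasis (liftCoupling β L) k ω g →
            StaticClauses k C β (liftFamily β φ g))
    (hD : ∀ k : ℕ, ∃ C lam0 : ℝ, 0 ≤ C ∧ 0 < lam0 ∧ ∀ lam : ℝ, 0 < lam → lam ≤ lam0 → ∃ L0 : ℕ,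
      ∀ (L : ℕ) [NeZero L], L0 ≤ L → ∀ β : ℝ, InFemtoWindow lam β L →
        ∀ φ : GaugeConfig 3 L SU2 → ℝ, IsRawVacuum β φ →
          ∃ (ω : GaugeConfig 3 1 SU2 → ℝ) (g : Fin k → (GaugeConfig 3 1 SU2 → ℝ)), LiftBasis (liftCoupling β L) k ω g ∧
            DynamicClauses k C β (liftFamily β φ g))
    (hK : ∀ k : ℕ, ∃ C lam0 : ℝ, 0 ≤ C ∧ 0 < lam0 ∧ ∀ lam : ℝ, 0 < lam → lam ≤ lam0 → ∃ L0 : ℕ,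
      ∀ (L : ℕ) [NeZero L], L0 ≤ L → ∀ β : ℝ, InFemtoWindow lam β L →
        ∀ φ : GaugeConfig 3 L SU2 → ℝ, IsRawVacuum β φ →
          ∀ (ω : GaugeConfig 3 1 SU2 → ℝ) (g : Fin k → (GaugeConfig 3 1 SU2 → ℝ)), LiftBasis (liftCoupling β L) k ω g →
            LeakageClause k C β (liftFamily β φ g))
    (k : ℕ) : OpPlat.OperatorPlateauAt k := by
  obtain ⟨C₁, l₁, hC₁, hl₁, h₁⟩ := hS k
  obtain ⟨C₂, l₂, -, hl₂, h₂⟩ := hD k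
  obtain ⟨C₃, l₃, -, hl₃, h₃⟩ := hK k
  refine ⟨max C₁ (max C₂ C₃), min l₁ (min l₂ l₃), hC₁.trans (le_max_left _ _), lt_min hl₁ (lt_min hl₂ hl₃), ?_⟩
  intro lam hlam hle
  obtain ⟨L₁, hL₁⟩ := h₁ lam hlam (hle.trans (min_le_left _ _))
  obtain ⟨L₂, hL₂⟩ := h₂ lam hlam (hle.trans ((min_le_right _ _).trans (min_le_left _ _)))
  obtain ⟨L₃, hL₃⟩ := h₃ lam hlam (hle.trans ((min_le_right _ _).trans (min_le_right _ _)))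
  refine ⟨max L₁ (max L₂ L₃), fun L _ hL β hW => ?_⟩
  have hle₁ : L₁ ≤ L := (le_max_left _ _).trans hL
  have hle₂ : L₂ ≤ L := ((le_max_left _ _).trans (le_max_right _ _)).trans hL
  have hle₃ : L₃ ≤ L := ((le_max_right _ _).trans (le_max_right _ _)).trans hL
  obtain ⟨Ω, θ, c, hΩ, -, -, hn, heig, -, -, -⟩ := PhysL2.exists_groundState (L := L) β
  have heig' : transferApply β Ω = levelValue su2Rep L β 0 • Ω := by rw [levelValue_zero]; exact heig
  have hvac : IsRawVacuum β Ω := ⟨hΩ, hn, heig'⟩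
  obtain ⟨ω, g, hbasis, hdyn⟩ := hL₂ L hle₂ β hW Ω hvac
  have hstat := hL₁ L hle₁ β hW Ω hvac ω g hbasis
  have hleak := hL₃ L hle₃ β hW Ω hvac ω g hbasis
  have hg : ∀ i, IsPhys (g i) := hbasis.2.2.2.2.1
  refine ⟨Ω, hΩ, hn, heig', fun i => flowLiftAt (L := L) 0 (flowTime β L) (g i), fun i => isPhys_flowLiftAt 0 _ (hg i), ?_⟩
  exact plateauClauses_of_parts hlam hW (fun i => isPhys_liftVec β hΩ (hg i)) (le_max_left _ _)
    ((le_max_left _ _).trans (le_max_right _ _)) ((le_max_right _ _).trans (le_max_right _ _)) hstat hdyn hleak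

/-- ★★ **STATICS → DYNAMICS → LEAKAGE → `Theses.LuscherReduction.DressedRitz`** (item stmt-QuantumFields-20205 BY NAME; stub bodies over tree
constants; door `OpPlat.dressedRitz_of_operatorPlateau`). [cite: Luscher1983, §3] [cite: LuscherWolff1990] -/
theorem dressedRitz_of_liftParts
    (hS : ∀ k : ℕ, ∃ C lam0 : ℝ, 0 ≤ C ∧ 0 < lam0 ∧ ∀ lam : ℝ, 0 < lam → lam ≤ lam0 → ∃ L0 : ℕ,
      ∀ (L : ℕ) [NeZero L], L0 ≤ L → ∀ β : ℝ, InFemtoWindow lam β L →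
        ∀ φ : GaugeConfig 3 L SU2 → ℝ, IsRawVacuum β φ →
          ∀ (ω : GaugeConfig 3 1 SU2 → ℝ) (g : Fin k → (GaugeConfig 3 1 SU2 → ℝ)), LiftBasis (liftCoupling β L) k ω g →
            StaticClauses k C β (liftFamily β φ g))
    (hD : ∀ k : ℕ, ∃ C lam0 : ℝ, 0 ≤ C ∧ 0 < lam0 ∧ ∀ lam : ℝ, 0 < lam → lam ≤ lam0 → ∃ L0 : ℕ,
      ∀ (L : ℕ) [NeZero L], L0 ≤ L → ∀ β : ℝ, InFemtoWindow lam β L →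
        ∀ φ : GaugeConfig 3 L SU2 → ℝ, IsRawVacuum β φ →
          ∃ (ω : GaugeConfig 3 1 SU2 → ℝ) (g : Fin k → (GaugeConfig 3 1 SU2 → ℝ)), LiftBasis (liftCoupling β L) k ω g ∧
            DynamicClauses k C β (liftFamily β φ g))
    (hK : ∀ k : ℕ, ∃ C lam0 : ℝ, 0 ≤ C ∧ 0 < lam0 ∧ ∀ lam : ℝ, 0 < lam → lam ≤ lam0 → ∃ L0 : ℕ,
      ∀ (L : ℕ) [NeZero L], L0 ≤ L → ∀ β : ℝ, InFemtoWindow lam β L →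
        ∀ φ : GaugeConfig 3 L SU2 → ℝ, IsRawVacuum β φ →
          ∀ (ω : GaugeConfig 3 1 SU2 → ℝ) (g : Fin k → (GaugeConfig 3 1 SU2 → ℝ)), LiftBasis (liftCoupling β L) k ω g →
            LeakageClause k C β (liftFamily β φ g)) :
    Summit.QuantumFields.YangMills.Theses.LuscherReduction.DressedRitz :=
  OpPlat.dressedRitz_of_operatorPlateau (operatorPlateauAt_of_liftParts hS hD hK)

/-! ## §3 ★★ The CORE composition: DYNAMICS may deliver (o5) ∧ (o6) only -/

/-- ★★ **STATICS ∧ DYNAMICS-CORE ∧ LEAKAGE ⇒ `OpPlat.OperatorPlateauAt k`.**  At `(L, β)` deep in the window (`λ ≤ 2·lam ≤ 1`, `B(β,L)` beyond the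
threshold of the coarse one-site law `TraceDoor.oneSiteLowerCoarse k 1`): take the DYNAMICS-CORE basis `g`, its lifted family `u`; (o0), (o2)
from STATICS and (o4) from LEAKAGE hold for `g`; raise all constants to `C = max C₁ (max C₂ C₃)`; RELABEL `u` by decreasing effective mass
(`KTGen.operatorCore_of_unsorted` ⇒ (o1)); add the spread (o7) by `KTGen.plateauClauses_of_core` (constant `|C| + Δ_k + 1`); the insertions are the
flowed-Polyakov lifts `flowLiftAt 0 (flowTime β L) (g (σ i))`. [cite: Luscher1983, §3] [cite: LuscherWolff1990] -/
theorem operatorPlateauAt_of_liftPartsCore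
    (hS : ∀ k : ℕ, ∃ C lam0 : ℝ, 0 ≤ C ∧ 0 < lam0 ∧ ∀ lam : ℝ, 0 < lam → lam ≤ lam0 → ∃ L0 : ℕ,
      ∀ (L : ℕ) [NeZero L], L0 ≤ L → ∀ β : ℝ, InFemtoWindow lam β L →
        ∀ φ : GaugeConfig 3 L SU2 → ℝ, IsRawVacuum β φ →
          ∀ (ω : GaugeConfig 3 1 SU2 → ℝ) (g : Fin k → (GaugeConfig 3 1 SU2 → ℝ)), LiftBasis (liftCoupling β L) k ω g →
            StaticClauses k C β (liftFamily β φ g))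
    (hD : ∀ k : ℕ, ∃ C lam0 : ℝ, 0 ≤ C ∧ 0 < lam0 ∧ ∀ lam : ℝ, 0 < lam → lam ≤ lam0 → ∃ L0 : ℕ,
      ∀ (L : ℕ) [NeZero L], L0 ≤ L → ∀ β : ℝ, InFemtoWindow lam β L →
        ∀ φ : GaugeConfig 3 L SU2 → ℝ, IsRawVacuum β φ →
          ∃ (ω : GaugeConfig 3 1 SU2 → ℝ) (g : Fin k → (GaugeConfig 3 1 SU2 → ℝ)), LiftBasis (liftCoupling β L) k ω g ∧
            DynamicCoreClauses k C β (liftFamily β φ g))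
    (hK : ∀ k : ℕ, ∃ C lam0 : ℝ, 0 ≤ C ∧ 0 < lam0 ∧ ∀ lam : ℝ, 0 < lam → lam ≤ lam0 → ∃ L0 : ℕ,
      ∀ (L : ℕ) [NeZero L], L0 ≤ L → ∀ β : ℝ, InFemtoWindow lam β L →
        ∀ φ : GaugeConfig 3 L SU2 → ℝ, IsRawVacuum β φ →
          ∀ (ω : GaugeConfig 3 1 SU2 → ℝ) (g : Fin k → (GaugeConfig 3 1 SU2 → ℝ)), LiftBasis (liftCoupling β L) k ω g →
            LeakageClause k C β (liftFamily β φ g))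
    (k : ℕ) : OpPlat.OperatorPlateauAt k := by
  obtain ⟨C₁, l₁, hC₁, hl₁, h₁⟩ := hS k
  obtain ⟨C₂, l₂, -, hl₂, h₂⟩ := hD k
  obtain ⟨C₃, l₃, -, hl₃, h₃⟩ := hK k
  obtain ⟨B0, hB0⟩ := oneSiteLowerCoarse k 1 one_pos
  set C : ℝ := max C₁ (max C₂ C₃) with hCdef
  have hC1 : C₁ ≤ C := le_max_left _ _
  have hC2 : C₂ ≤ C := (le_max_left _ _).trans (le_max_right _ _)
  have hC3 : C₃ ≤ C := (le_max_right _ _).trans (le_max_right _ _)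
  have hgk : 0 ≤ levelGap k := levelGap_nonneg k
  refine ⟨|C| + levelGap k + 1, min (min l₁ (min l₂ l₃)) (min (1 / 2) (1 / (4 * max B0 1))), by positivity,
    lt_min (lt_min hl₁ (lt_min hl₂ hl₃)) (lt_min (by norm_num) (by positivity)), ?_⟩
  intro lam hlam hle
  have hleA : lam ≤ min l₁ (min l₂ l₃) := hle.trans (min_le_left _ _)
  obtain ⟨L₁, hL₁⟩ := h₁ lam hlam (hleA.trans (min_le_left _ _))
  obtain ⟨L₂, hL₂⟩ := h₂ lam hlam (hleA.trans ((min_le_right _ _).trans (min_le_left _ _)))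
  obtain ⟨L₃, hL₃⟩ := h₃ lam hlam (hleA.trans ((min_le_right _ _).trans (min_le_right _ _)))
  refine ⟨max L₁ (max L₂ L₃), fun L _ hL β hW => ?_⟩
  have hle₁ : L₁ ≤ L := (le_max_left _ _).trans hL
  have hle₂ : L₂ ≤ L := ((le_max_left _ _).trans (le_max_right _ _)).trans hL
  have hle₃ : L₃ ≤ L := ((le_max_right _ _).trans (le_max_right _ _)).trans hL
  have hlam_half : lam ≤ 1 / 2 := (hle.trans (min_le_right _ _)).trans (min_le_left _ _)
  have hlam1 : lam ≤ 1 := hlam_half.trans (by norm_num)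
  have hlamB : lam ≤ 1 / (4 * max B0 1) := (hle.trans (min_le_right _ _)).trans (min_le_right _ _)
  have hβ0 : (0 : ℝ) ≤ β := zero_le_one.trans hW.1
  have hB : B0 ≤ oneSiteCoupling β L := oneSiteCoupling_ge_of_small_level hlam hlam1 hlamB hW
  have hlpos : 0 < luscherLambda β L := luscherLambda_pos_of_window hlam hW
  have hΛ : 0 ≤ luscherLambda β L := hlpos.le
  have hl1 : luscherLambda β L ≤ 1 := by linarith [hW.2.2]
  have hLpos : (0 : ℝ) < L := Nat.cast_pos.mpr (NeZero.pos L)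
  -- the Perron–Frobenius vacuum
  obtain ⟨Ω, θ, c, hΩ, -, -, hn, heig, -, -, -⟩ := PhysL2.exists_groundState (L := L) β
  have heig' : transferApply β Ω = levelValue su2Rep L β 0 • Ω := by rw [levelValue_zero]; exact heig
  have hvac : IsRawVacuum β Ω := ⟨hΩ, hn, heig'⟩
  -- DYNAMICS-CORE picks the basis; STATICS and LEAKAGE hold for it
  obtain ⟨ω, g, hbasis, ho5, ho6⟩ := hL₂ L hle₂ β hW Ω hvac
  obtain ⟨ho0, ho2⟩ := hL₁ L hle₁ β hW Ω hvac ω g hbasis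
  have ho4 := hL₃ L hle₃ β hW Ω hvac ω g hbasis
  have hg : ∀ i, IsPhys (g i) := hbasis.2.2.2.2.1
  set u : Fin k → (GaugeConfig 3 L SU2 → ℝ) := liftFamily β Ω g with hu_def
  have hu : ∀ i, IsPhys (u i) := fun i => isPhys_liftVec β hΩ (hg i)
  -- sign facts and the raise of all constants to `C`
  have htop0 : 0 ≤ levelValue su2Rep L β 0 := (levelValue_pos_of_window hW 0).le
  have hBpos : 0 < oneSiteCoupling β L := by
    unfold oneSiteCoupling
    exact div_pos (mul_pos two_pos (pow_pos hLpos 3)) (pow_pos hlpos 3)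
  have hμ : ∀ j : ℕ, 0 ≤ levelValue su2Rep 1 (oneSiteCoupling β L) j := fun j => levelValue_su2Rep_nonneg 1 hBpos.le j
  have hnn : ∀ i : Fin k, 0 ≤ l2 (u i) (u i) := fun i => l2_self_nonneg _
  have hd : ∀ i : Fin k, 0 ≤ l2 (u i) (transferApply β (u i)) := fun i => by
    rw [← qform_eq_l2_transferApply]; exact qform_su2Rep_self_nonneg hβ0 (hu i)
  have hsq : ∀ i l : Fin k, 0 ≤ Real.sqrt (l2 (u i) (u i)) * Real.sqrt (l2 (u l) (u l)) :=
    fun i l => mul_nonneg (Real.sqrt_nonneg _) (Real.sqrt_nonneg _)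
  have key : ∀ {a b x : ℝ}, a ≤ b → 0 ≤ x → a * x ≤ b * x := fun h hx => mul_le_mul_of_nonneg_right h hx
  have hexp : Real.exp (C₂ * luscherLambda β L ^ 2 / L) ≤ Real.exp (C * luscherLambda β L ^ 2 / L) :=
    Real.exp_le_exp.mpr (div_le_div_of_nonneg_right (key hC2 (sq_nonneg _)) hLpos.le)
  have h2' : ∀ i l : Fin k, i ≠ l →
      |l2 (u i) (u l)| ≤ C * luscherLambda β L * (Real.sqrt (l2 (u i) (u i)) * Real.sqrt (l2 (u l) (u l))) :=
    fun i l hil => (ho2 i l hil).trans (key (key hC1 hΛ) (hsq i l))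
  have h4' : ∀ i : Fin k,
      l2 (transferApply β (u i)) (transferApply β (u i)) * l2 (u i) (u i) - l2 (u i) (transferApply β (u i)) ^ 2
        ≤ C * (luscherLambda β L ^ 3 / (L : ℝ) ^ 2) * levelValue su2Rep L β 0 ^ 2 * l2 (u i) (u i) ^ 2 :=
    fun i => (ho4 i).trans (key (key (key hC3 (div_nonneg (pow_nonneg hΛ 3) (sq_nonneg _))) (sq_nonneg _)) (sq_nonneg _))
  have h5' : ∀ i : Fin k,
      l2 (u i) (transferApply β (u i)) * levelValue su2Rep 1 (oneSiteCoupling β L) 0 ≤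
          Real.exp (C * luscherLambda β L ^ 2 / L) *
            (levelValue su2Rep 1 (oneSiteCoupling β L) ((i : ℕ) + 1) * levelValue su2Rep L β 0) * l2 (u i) (u i) ∧
      levelValue su2Rep 1 (oneSiteCoupling β L) ((i : ℕ) + 1) * levelValue su2Rep L β 0 * l2 (u i) (u i) ≤
          Real.exp (C * luscherLambda β L ^ 2 / L) *
            (l2 (u i) (transferApply β (u i)) * levelValue su2Rep 1 (oneSiteCoupling β L) 0) :=
    fun i => ⟨(ho5 i).1.trans (key (key hexp (mul_nonneg (hμ _) htop0)) (hnn i)), (ho5 i).2.trans (key hexp (mul_nonneg (hd i) (hμ 0)))⟩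
  have h6' : ∀ i l : Fin k, i ≠ l →
      |l2 (u i) (transferApply β (u l)) -
          (l2 (u i) (transferApply β (u i)) / l2 (u i) (u i) + l2 (u l) (transferApply β (u l)) / l2 (u l) (u l)) / 2 *
            l2 (u i) (u l)|
        ≤ C * (luscherLambda β L ^ 2 / L) * levelValue su2Rep L β 0 *
            (Real.sqrt (l2 (u i) (u i)) * Real.sqrt (l2 (u l) (u l))) :=
    fun i l hil => (ho6 i l hil).trans (key (key (key hC2 (div_nonneg (sq_nonneg _) hLpos.le)) htop0) (hsq i l))
  -- RELABEL by decreasing effective mass ⇒ (o1); then the spread (o7) from (o5) + ONE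
  obtain ⟨σ, g0, g1, g2, g4, g5, g6⟩ := operatorCore_of_unsorted hβ0 ho0 h2' h4' h5' h6'
  have hcl := plateauClauses_of_core hB0 hB hβ0 hlpos hl1 g0 g1 g2 g4 g5 g6
  exact ⟨Ω, hΩ, hn, heig', fun i => flowLiftAt (L := L) 0 (flowTime β L) (g (σ i)), fun i => isPhys_flowLiftAt 0 _ (hg (σ i)), hcl⟩

/-- ★★★ **STATICS → DYNAMICS-CORE → LEAKAGE → `Theses.LuscherReduction.DressedRitz`** (item stmt-QuantumFields-20205 BY NAME): the DYNAMICS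
stub of «polyakovlift» may be weakened to `DynamicCoreClauses` = (o5) ∧ (o6) for SOME lift basis. [cite: Luscher1983, §3] [cite: LuscherWolff1990] -/
theorem dressedRitz_of_liftPartsCore
    (hS : ∀ k : ℕ, ∃ C lam0 : ℝ, 0 ≤ C ∧ 0 < lam0 ∧ ∀ lam : ℝ, 0 < lam → lam ≤ lam0 → ∃ L0 : ℕ,
      ∀ (L : ℕ) [NeZero L], L0 ≤ L → ∀ β : ℝ, InFemtoWindow lam β L →
        ∀ φ : GaugeConfig 3 L SU2 → ℝ, IsRawVacuum β φ →
          ∀ (ω : GaugeConfig 3 1 SU2 → ℝ) (g : Fin k → (GaugeConfig 3 1 SU2 → ℝ)), LiftBasis (liftCoupling β L) k ω g →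
            StaticClauses k C β (liftFamily β φ g))
    (hD : ∀ k : ℕ, ∃ C lam0 : ℝ, 0 ≤ C ∧ 0 < lam0 ∧ ∀ lam : ℝ, 0 < lam → lam ≤ lam0 → ∃ L0 : ℕ,
      ∀ (L : ℕ) [NeZero L], L0 ≤ L → ∀ β : ℝ, InFemtoWindow lam β L →
        ∀ φ : GaugeConfig 3 L SU2 → ℝ, IsRawVacuum β φ →
          ∃ (ω : GaugeConfig 3 1 SU2 → ℝ) (g : Fin k → (GaugeConfig 3 1 SU2 → ℝ)), LiftBasis (liftCoupling β L) k ω g ∧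
            DynamicCoreClauses k C β (liftFamily β φ g))
    (hK : ∀ k : ℕ, ∃ C lam0 : ℝ, 0 ≤ C ∧ 0 < lam0 ∧ ∀ lam : ℝ, 0 < lam → lam ≤ lam0 → ∃ L0 : ℕ,
      ∀ (L : ℕ) [NeZero L], L0 ≤ L → ∀ β : ℝ, InFemtoWindow lam β L →
        ∀ φ : GaugeConfig 3 L SU2 → ℝ, IsRawVacuum β φ →
          ∀ (ω : GaugeConfig 3 1 SU2 → ℝ) (g : Fin k → (GaugeConfig 3 1 SU2 → ℝ)), LiftBasis (liftCoupling β L) k ω g →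
            LeakageClause k C β (liftFamily β φ g)) :
    Summit.QuantumFields.YangMills.Theses.LuscherReduction.DressedRitz :=
  OpPlat.dressedRitz_of_operatorPlateau (operatorPlateauAt_of_liftPartsCore hS hD hK)

end Summit.QuantumFields.YangMills.Theorems.FemtoTransferGap.PolyakovLift

end
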